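import Summits.Langlands.Langlands.Theorems.IrreducibilityBySelfDualityReciprocityUpToIrreducibilityCorrespondsConj
import Summits.Langlands.Langlands.Theorems.IrreducibilityBySelfDualityReciprocityUpToIrreducibilityDecoupling
import HarnessLib

/-!
# Tightness of line `Sketch` for the crux `ReciprocityUpToIrreducibility` (item stmt-Langlands-14328):
# the crux implies each of its open stubs, so `E ↔ W ∧ B_w ∧ LGC` modulo Arthur–Clozel (2.2)–(2.3)

Support file (closes nothing; lands the registered stub `stub_correspondsOfExistsCorresponds`,
continuation lead c2).  Line `Sketch` decouples the crux `E = ReciprocityUpToIrreducibility` into the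
open statements **W** (weak existence: Buzzard–Gee Conj. 3.2.2 without irreducibility, uniqueness or
local–global compatibility), **B_w** (Fontaine–Mazur–Langlands, a.e. form) and **LGC** (local–global
compatibility at every finite place for irreducible pairs, the only clause carrying `∃ Rec`), and the
tree already has the composition `reciprocityUpToIrreducibility_of_weak : (2.2) → (2.3) → W → B_w →
LGC → E` (`…Decoupling`, p116715).  This file proves the CONVERSES, unconditionally:

* `weakExistence_of_reciprocityUpToIrreducibility : E → W` and
  `weakAutomorphy_of_reciprocityUpToIrreducibility : E → B_w` (read off the two directions of `E`);
* `pairCompatibility_of_reciprocityUpToIrreducibility : E → LGC` — the weak-to-strong upgrade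
  (`corresponds_of_exists_corresponds` of `…CorrespondsConj`: direction (A') of `E` gives SOME `ρ_π`
  corresponding to `π` everywhere; an irreducible `ρ` a.e.-compatible with `π` is conjugate to it by
  Chebotarev + Brauer–Nesbitt, and `Corresponds` descends to conjugacy classes), with the crux's own
  `Rec`; in particular `E` implies the `∃ Rec` statement of the registered stub
  `stub_pairCompatibilityAway` verbatim (`pairCompatibilityAway_of_reciprocityUpToIrreducibility`);
* `reciprocityUpToIrreducibility_iff_weak : (2.2) → (2.3) → (E ↔ W ∧ B_w ∧ LGC)`.

So along this line none of W, B_w, LGC can be weakened: each is implied by the crux (they are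
honestly crux-sized — W is BG Conj. 3.2.2 in its weak form, B_w follows from the named text lang.S03,
LGC is Taylor's Conj. 7 for irreducible pairs).  W, B_w, LGC are stated verbatim (the registered stub
signatures of `Lines/Sketch.lean`), unfolded, as in `…Decoupling`.  No definitions; std axioms.
-/

noncomputable section

set_option linter.dupNamespace false -- project-wide option (lakefile weak.linter.dupNamespace); `Summit.Langlands.Langlands` is the mandated namespace

open scoped MatrixGroups NumberField Classical
open Filter IsDedekindDomain
open Literature.NumberTheory.Automorphic Literature.NumberTheory.GaloisRepresentations
open Summit.Langlands
open Summit.Langlands.Langlands.Theses.IrreducibilityBySelfDuality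

namespace Summit.Langlands.Langlands.Theorems.ReciprocityUpToIrreducibility

/-- **Registered stub `stub_correspondsOfExistsCorresponds` of line `Sketch` (crux stmt-Langlands-14328),
verbatim — the weak-to-strong upgrade**: if SOME `ρ'` corresponds to `π` at every finite place, then
every irreducible `ρ` Satake–Frobenius compatible with `π` at almost all places corresponds to `π` at
every finite place (same `Rec`, same `ι`).  By `corresponds_of_exists_corresponds`.
[cite: DeligneSerreASENS1974, Lemme 3.2] -/
theorem stub_correspondsOfExistsCorresponds :
    ∀ (K : Type) [Field K] [NumberField K] (n : ℕ) (hcpt : isCompact_glFiniteIntegralLevel n K)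
      (Rec : ReciprocityData K) (ℓ : ℕ) [Fact ℓ.Prime] (ι : PadicAlgCl ℓ ≃+* ℂ)
      (π : CuspidalAutomorphicRepData n K hcpt) (ρ : FramedGaloisRep K (PadicAlgCl ℓ) n),
      ρ.toGaloisRep.IsIrreducible →
      (∀ᶠ v : HeightOneSpectrum (𝓞 K) in cofinite, SatakeFrobCompatibleAt ι π.1 ρ v) →
      (∃ ρ' : FramedGaloisRep K (PadicAlgCl ℓ) n, Corresponds Rec ι π.1 ρ') →
        Corresponds Rec ι π.1 ρ :=
  fun _K _ _ _n _hcpt _Rec _ℓ _ _ι _π _ρ hirr hρ hA => corresponds_of_exists_corresponds hirr hρ hA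

/-- **Tightness, W: the crux implies weak existence** (the registered stub `stub_weakExistence`,
verbatim) — read off direction (A') of `E`. [cite: BuzzardGeeLMS2014, Conj. 3.2.2] -/
theorem weakExistence_of_reciprocityUpToIrreducibility (hE : ReciprocityUpToIrreducibility) :
    ∀ (K : Type) [Field K] [NumberField K] (n : ℕ) (hcpt : isCompact_glFiniteIntegralLevel n K),
      0 < n → ∀ π : CuspidalAutomorphicRepData n K hcpt, π.1.IsLAlgebraic →
        ∀ (ℓ : ℕ) [Fact ℓ.Prime] (ι : PadicAlgCl ℓ ≃+* ℂ),
          ∃ ρ : FramedGaloisRep K (PadicAlgCl ℓ) n,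
            ((∀ᶠ v : HeightOneSpectrum (𝓞 K) in cofinite, ρ.IsUnramifiedAt v) ∧
              ∀ (v : HeightOneSpectrum (𝓞 K)) (hv : ((ℓ : ℕ) : 𝓞 K) ∈ v.asIdeal),
                (Literature.NumberTheory.PAdicHodge.fontainePstAdicCompletion v ℓ hv).IsDeRhamFramed
                  (ρ.toLocal v)) ∧
            ∀ᶠ v : HeightOneSpectrum (𝓞 K) in cofinite, SatakeFrobCompatibleAt ι π.1 ρ v := by
  intro K _ _ n hcpt hn π hL ℓ _ ι
  obtain ⟨Rec, hRec⟩ := hE K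
  obtain ⟨hA, -⟩ := hRec n hn hcpt
  obtain ⟨ρ, hgeo, hcorr⟩ := hA π hL ℓ ι
  exact ⟨ρ, hgeo, hcorr.1⟩

/-- **Tightness, B_w: the crux implies weak automorphy** (the former registered stub
`stub_weakAutomorphy`, verbatim) — read off direction (B) of `E`. [cite: FontaineMazurGeometric1995, Conj. 1] -/
theorem weakAutomorphy_of_reciprocityUpToIrreducibility (hE : ReciprocityUpToIrreducibility) :
    ∀ (K : Type) [Field K] [NumberField K] (n : ℕ) (hcpt : isCompact_glFiniteIntegralLevel n K),
      0 < n → ∀ (ℓ : ℕ) [Fact ℓ.Prime] (ι : PadicAlgCl ℓ ≃+* ℂ) (ρ : FramedGaloisRep K (PadicAlgCl ℓ) n),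
        ρ.toGaloisRep.IsIrreducible →
        ((∀ᶠ v : HeightOneSpectrum (𝓞 K) in cofinite, ρ.IsUnramifiedAt v) ∧
          ∀ (v : HeightOneSpectrum (𝓞 K)) (hv : ((ℓ : ℕ) : 𝓞 K) ∈ v.asIdeal),
            (Literature.NumberTheory.PAdicHodge.fontainePstAdicCompletion v ℓ hv).IsDeRhamFramed
              (ρ.toLocal v)) →
          ∃ π : CuspidalAutomorphicRepData n K hcpt, π.1.IsLAlgebraic ∧
            ∀ᶠ v : HeightOneSpectrum (𝓞 K) in cofinite, SatakeFrobCompatibleAt ι π.1 ρ v := by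
  intro K _ _ n hcpt hn ℓ _ ι ρ hirr hgeo
  obtain ⟨Rec, hRec⟩ := hE K
  obtain ⟨-, hB⟩ := hRec n hn hcpt
  obtain ⟨π, hL, hcorr⟩ := hB ℓ ι ρ hirr hgeo
  exact ⟨π, hL, hcorr.1⟩

/-- **Tightness, LGC: the crux implies local–global compatibility for irreducible pairs** (the
statement `PairCompatibility` of the line, verbatim), with the crux's own reciprocity datum: for an
irreducible `ρ` a.e.-compatible with an L-algebraic cuspidal `π`, direction (A') of `E` gives some
`ρ_π` corresponding to `π` at every finite place, and the weak-to-strong upgrade transfers the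
correspondence to `ρ`.  The geometricity hypothesis is not used. [cite: DeligneSerreASENS1974, Lemme 3.2] -/
theorem pairCompatibility_of_reciprocityUpToIrreducibility (hE : ReciprocityUpToIrreducibility) :
    ∀ (K : Type) [Field K] [NumberField K], ∃ Rec : ReciprocityData K,
      ∀ (n : ℕ) (hcpt : isCompact_glFiniteIntegralLevel n K), 0 < n →
        ∀ (π : CuspidalAutomorphicRepData n K hcpt), π.1.IsLAlgebraic →
          ∀ (ℓ : ℕ) [Fact ℓ.Prime] (ι : PadicAlgCl ℓ ≃+* ℂ) (ρ : FramedGaloisRep K (PadicAlgCl ℓ) n),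
            ρ.toGaloisRep.IsIrreducible →
            ((∀ᶠ v : HeightOneSpectrum (𝓞 K) in cofinite, ρ.IsUnramifiedAt v) ∧
              ∀ (v : HeightOneSpectrum (𝓞 K)) (hv : ((ℓ : ℕ) : 𝓞 K) ∈ v.asIdeal),
                (Literature.NumberTheory.PAdicHodge.fontainePstAdicCompletion v ℓ hv).IsDeRhamFramed
                  (ρ.toLocal v)) →
              (∀ᶠ v : HeightOneSpectrum (𝓞 K) in cofinite, SatakeFrobCompatibleAt ι π.1 ρ v) →
                ∀ v : HeightOneSpectrum (𝓞 K), LocalGlobalCompatibleAt Rec ι π.1 ρ v := by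
  intro K _ _
  obtain ⟨Rec, hRec⟩ := hE K
  refine ⟨Rec, fun n hcpt hn π hL ℓ _ ι ρ hirr _ hρ => ?_⟩
  obtain ⟨hA, -⟩ := hRec n hn hcpt
  obtain ⟨ρ', -, hcorr'⟩ := hA π hL ℓ ι
  exact (corresponds_of_exists_corresponds hirr hρ ⟨ρ', hcorr'⟩).2

/-- **The crux implies the registered stub `stub_pairCompatibilityAway` (verbatim)** — local–global
compatibility away from `ℓ` for irreducible pairs, `∃ Rec` form: a special case of
`pairCompatibility_of_reciprocityUpToIrreducibility`. [cite: DeligneSerreASENS1974, Lemme 3.2] -/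
theorem pairCompatibilityAway_of_reciprocityUpToIrreducibility (hE : ReciprocityUpToIrreducibility) :
    ∀ (K : Type) [Field K] [NumberField K], ∃ Rec : ReciprocityData K,
      ∀ (n : ℕ) (hcpt : isCompact_glFiniteIntegralLevel n K), 0 < n →
        ∀ (π : CuspidalAutomorphicRepData n K hcpt), π.1.IsLAlgebraic →
          ∀ (ℓ : ℕ) [Fact ℓ.Prime] (ι : PadicAlgCl ℓ ≃+* ℂ) (ρ : FramedGaloisRep K (PadicAlgCl ℓ) n),
            ρ.toGaloisRep.IsIrreducible →
            ((∀ᶠ v : HeightOneSpectrum (𝓞 K) in cofinite, ρ.IsUnramifiedAt v) ∧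
              ∀ (v : HeightOneSpectrum (𝓞 K)) (hv : ((ℓ : ℕ) : 𝓞 K) ∈ v.asIdeal),
                (Literature.NumberTheory.PAdicHodge.fontainePstAdicCompletion v ℓ hv).IsDeRhamFramed
                  (ρ.toLocal v)) →
              (∀ᶠ v : HeightOneSpectrum (𝓞 K) in cofinite, SatakeFrobCompatibleAt ι π.1 ρ v) →
                ∀ v : HeightOneSpectrum (𝓞 K), ((ℓ : ℕ) : 𝓞 K) ∉ v.asIdeal →
                  LocalGlobalCompatibleAt Rec ι π.1 ρ v := by
  intro K _ _
  obtain ⟨Rec, hRec⟩ := pairCompatibility_of_reciprocityUpToIrreducibility hE K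
  exact ⟨Rec, fun n hcpt hn π hL ℓ _ ι ρ hirr hgeo hρ v _ => hRec n hcpt hn π hL ℓ ι ρ hirr hgeo hρ v⟩

/-- **The decoupling of line `Sketch` is an equivalence modulo Arthur–Clozel (2.2)–(2.3):**
`E ↔ W ∧ B_w ∧ LGC`.  `←` is the tree's composition `reciprocityUpToIrreducibility_of_weak`
(bootstrap irreducibility from Jacquet–Shalika rigidity, the only place the two analytic facts enter);
`→` is unconditional (the three theorems above). [cite: BuzzardGeeLMS2014, Conj. 3.2.2] -/
theorem reciprocityUpToIrreducibility_iff_weak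
    (h22 : JacquetShalika1981_partialPairL_boundary_repData)
    (h23 : JacquetShalika1981_partialPairL_pole_repData) :
    ReciprocityUpToIrreducibility ↔
    ((∀ (K : Type) [Field K] [NumberField K] (n : ℕ) (hcpt : isCompact_glFiniteIntegralLevel n K),
      0 < n → ∀ π : CuspidalAutomorphicRepData n K hcpt, π.1.IsLAlgebraic →
        ∀ (ℓ : ℕ) [Fact ℓ.Prime] (ι : PadicAlgCl ℓ ≃+* ℂ),
          ∃ ρ : FramedGaloisRep K (PadicAlgCl ℓ) n,
            ((∀ᶠ v : HeightOneSpectrum (𝓞 K) in cofinite, ρ.IsUnramifiedAt v) ∧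
              ∀ (v : HeightOneSpectrum (𝓞 K)) (hv : ((ℓ : ℕ) : 𝓞 K) ∈ v.asIdeal),
                (Literature.NumberTheory.PAdicHodge.fontainePstAdicCompletion v ℓ hv).IsDeRhamFramed
                  (ρ.toLocal v)) ∧
            ∀ᶠ v : HeightOneSpectrum (𝓞 K) in cofinite, SatakeFrobCompatibleAt ι π.1 ρ v) ∧
    (∀ (K : Type) [Field K] [NumberField K] (n : ℕ) (hcpt : isCompact_glFiniteIntegralLevel n K),
      0 < n → ∀ (ℓ : ℕ) [Fact ℓ.Prime] (ι : PadicAlgCl ℓ ≃+* ℂ) (ρ : FramedGaloisRep K (PadicAlgCl ℓ) n),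
        ρ.toGaloisRep.IsIrreducible →
        ((∀ᶠ v : HeightOneSpectrum (𝓞 K) in cofinite, ρ.IsUnramifiedAt v) ∧
          ∀ (v : HeightOneSpectrum (𝓞 K)) (hv : ((ℓ : ℕ) : 𝓞 K) ∈ v.asIdeal),
            (Literature.NumberTheory.PAdicHodge.fontainePstAdicCompletion v ℓ hv).IsDeRhamFramed
              (ρ.toLocal v)) →
          ∃ π : CuspidalAutomorphicRepData n K hcpt, π.1.IsLAlgebraic ∧
            ∀ᶠ v : HeightOneSpectrum (𝓞 K) in cofinite, SatakeFrobCompatibleAt ι π.1 ρ v) ∧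
    (∀ (K : Type) [Field K] [NumberField K], ∃ Rec : ReciprocityData K,
      ∀ (n : ℕ) (hcpt : isCompact_glFiniteIntegralLevel n K), 0 < n →
        ∀ (π : CuspidalAutomorphicRepData n K hcpt), π.1.IsLAlgebraic →
          ∀ (ℓ : ℕ) [Fact ℓ.Prime] (ι : PadicAlgCl ℓ ≃+* ℂ) (ρ : FramedGaloisRep K (PadicAlgCl ℓ) n),
            ρ.toGaloisRep.IsIrreducible →
            ((∀ᶠ v : HeightOneSpectrum (𝓞 K) in cofinite, ρ.IsUnramifiedAt v) ∧
              ∀ (v : HeightOneSpectrum (𝓞 K)) (hv : ((ℓ : ℕ) : 𝓞 K) ∈ v.asIdeal),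
                (Literature.NumberTheory.PAdicHodge.fontainePstAdicCompletion v ℓ hv).IsDeRhamFramed
                  (ρ.toLocal v)) →
              (∀ᶠ v : HeightOneSpectrum (𝓞 K) in cofinite, SatakeFrobCompatibleAt ι π.1 ρ v) →
                ∀ v : HeightOneSpectrum (𝓞 K), LocalGlobalCompatibleAt Rec ι π.1 ρ v)) :=
  ⟨fun hE => ⟨weakExistence_of_reciprocityUpToIrreducibility hE,
      weakAutomorphy_of_reciprocityUpToIrreducibility hE,
      pairCompatibility_of_reciprocityUpToIrreducibility hE⟩,
    fun h => reciprocityUpToIrreducibility_of_weak h22 h23 h.1 h.2.1 h.2.2⟩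

end Summit.Langlands.Langlands.Theorems.ReciprocityUpToIrreducibility

end
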